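import Mathlib
import Summits.ValiantsHypothesis.ValiantsHypothesis.Theorems.GirthSidonPolySwallowForcesShortRelationTotallyBorn
import Summits.ValiantsHypothesis.ValiantsHypothesis.Theorems.GirthSidonPolySwallowForcesShortRelationBornRank
import Summits.ValiantsHypothesis.ValiantsHypothesis.Theorems.GirthSidonPolySwallowForcesShortRelationHeight
import Summits.ValiantsHypothesis.ValiantsHypothesis.Theorems.GirthSidonPolySwallowForcesShortRelationTwoEndedBudget

/-!
# Route GirthSidon — crux `PolySwallowForcesShortRelation` (stmt-ValiantsHypothesis-6537), line
`two_ended_honesty`: the SHAPE OF A COUNTEREXAMPLE to the residual stub `stub_totallyBornTargets`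

One kernel-checked statement collecting the necessary conditions landed in
`…TotallyBorn.lean`, `…BornRank.lean`, `…Height.lean`, `…TwoEndedBudget.lean`: if a quadratic polynomial
swallowing `Γ_i(y) = x^{d_i}` (`i < m`, `y : Fin s → ℂ[x]`) has all targets TOTALLY BORN and NO relation of
length `≤ 30`, then
1. `d` is injective;
2. HEIGHT: for every `H` bounding all source degrees, `C(m+29, 30) ≤ 60 H + 1`;
3. RANK: for every set `J` of monomial sources (`y_j = c_j x^{a_j}`, `c_j ≠ 0`) and every `r ≥ s − |J|`,
   `m ≤ r (2(s+1) + r)` — polynomially many genuinely non-monomial sources;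
4. BUDGET at both ends: with `n = dim span(1,y) ≤ s+1`, `O₀`/`O_∞` its order/degree sets (`|O₀| = |O_∞| = n`),
   `m + |O₀ + O₀| ≤ C(n+1,2)` and `m + |O_∞ + O_∞| ≤ C(n+1,2)` (so neither end is Sidon-like).
Nothing here bounds the residual itself; VP ≠ VNP is not moved. [folklore]
-/

set_option linter.dupNamespace false

namespace Summit.ValiantsHypothesis.ValiantsHypothesis.Theorems

open Polynomial
open scoped Pointwise

namespace PolySwallowShape

/-- **Shape of a counterexample to `stub_totallyBornTargets`.**  See the module docstring: injectivity,
height `C(m+29,30) ≤ 60H+1`, rank `m ≤ r(2(s+1)+r)` for the number `r` of non-monomial sources, and the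
two-ended budget `m + |O+O| ≤ C(n+1,2)` at both ends. [folklore] -/
theorem counterexample_shape {m s : ℕ} (d : Fin m → ℕ)
    (Γ : Fin m → MvPolynomial (Fin s) ℂ) (y : Fin s → Polynomial ℂ)
    (hΓ : ∀ i, (Γ i).totalDegree ≤ 2) (hy : ∀ i, MvPolynomial.aeval y (Γ i) = Polynomial.X ^ d i)
    (hTB : ∀ i, ∀ f ∈ Submodule.span ℂ (insert 1 (Set.range y)),
      ∀ g ∈ Submodule.span ℂ (insert 1 (Set.range y)), f ≠ 0 → g ≠ 0 →
        d i ≠ f.natTrailingDegree + g.natTrailingDegree ∧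
        d i ≠ f.natTrailingDegree + g.natDegree ∧
        d i ≠ f.natDegree + g.natDegree)
    (hno : ¬ ∃ S T : Multiset (Fin m), S ≠ T ∧ Multiset.card S ≤ 30 ∧ Multiset.card T ≤ 30 ∧
      (S.map d).sum = (T.map d).sum) :
    Function.Injective d ∧
    (∀ H : ℕ, (∀ j, (y j).natDegree ≤ H) → Nat.choose (m + 29) 30 ≤ 60 * H + 1) ∧
    (∀ (J : Finset (Fin s)) (a : Fin s → ℕ) (c : Fin s → ℂ) (r : ℕ),
      (∀ j ∈ J, c j ≠ 0 ∧ y j = Polynomial.C (c j) * Polynomial.X ^ (a j)) → s ≤ J.card + r →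
      m ≤ r * (2 * (s + 1) + r)) ∧
    (∃ (n : ℕ) (O₀ Oinf : Finset ℕ), n ≤ s + 1 ∧
      (↑O₀ = {e : ℕ | ∃ v ∈ Submodule.span ℂ (insert (1 : ℂ[X]) (Set.range y)),
        v ≠ 0 ∧ v.natTrailingDegree = e}) ∧
      (↑Oinf = {e : ℕ | ∃ v ∈ Submodule.span ℂ (insert (1 : ℂ[X]) (Set.range y)),
        v ≠ 0 ∧ v.natDegree = e}) ∧
      O₀.card = n ∧ Oinf.card = n ∧
      m + (O₀ + O₀).card ≤ (n + 1).choose 2 ∧ m + (Oinf + Oinf).card ≤ (n + 1).choose 2) := by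
  classical
  -- 1. injectivity
  have hinj : Function.Injective d := by
    by_contra h
    exact hno (PolySwallowTotallyBorn.relation_of_not_injective d h)
  refine ⟨hinj, ?_, ?_, ?_⟩
  -- 2. height
  · intro H hH
    by_contra hlt
    exact hno (PolySwallowHeight.relation_of_low_degree_sources d Γ y hΓ hy hH (by omega))
  -- 3. rank
  · intro J a c r hJ hr
    by_contra hlt
    refine hno (PolySwallowBornRank.relation_of_few_nonMonomial_sources d Γ y hΓ hy J a c
      (fun j hj => (hJ j hj).2) hr ?_ (by omega))
    intro i u hu v hv
    -- every element of `insert 0 (J.image a)` is the order and the degree of a nonzero element of `V`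
    have hwit : ∀ w ∈ insert 0 (J.image a), ∃ f ∈ Submodule.span ℂ (insert 1 (Set.range y)),
        f ≠ 0 ∧ f.natTrailingDegree = w ∧ f.natDegree = w := by
      intro w hw
      rcases Finset.mem_insert.mp hw with rfl | hw
      · exact ⟨1, Submodule.subset_span (Set.mem_insert _ _), one_ne_zero, by simp, by simp⟩
      · obtain ⟨j, hj, rfl⟩ := Finset.mem_image.mp hw
        obtain ⟨hc, hyj⟩ := hJ j hj
        refine ⟨y j, Submodule.subset_span (Set.mem_insert_of_mem _ ⟨j, rfl⟩), ?_, ?_, ?_⟩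
        · rw [hyj]; exact mul_ne_zero (Polynomial.C_ne_zero.mpr hc) (pow_ne_zero _ Polynomial.X_ne_zero)
        · rw [hyj, Polynomial.C_mul_X_pow_eq_monomial, Polynomial.natTrailingDegree_monomial hc]
        · rw [hyj, Polynomial.C_mul_X_pow_eq_monomial, Polynomial.natDegree_monomial_eq _ hc]
    obtain ⟨f, hf, hf0, hfu, -⟩ := hwit u hu
    obtain ⟨g, hg, hg0, hgv, -⟩ := hwit v hv
    have h := (hTB i f hf g hg hf0 hg0).1
    rwa [hfu, hgv] at h
  -- 4. budget at both ends
  · obtain ⟨n, O₀, Oinf, hn, hO₀, hOinf, hc₀, hcinf, hb₀, hbinf⟩ :=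
      PolySwallowBudget.twoEnded_budget y d hinj Γ hΓ hy
    refine ⟨n, O₀, Oinf, hn, hO₀, hOinf, hc₀, hcinf, ?_, ?_⟩
    · have hall : (Finset.univ.filter fun i : Fin m => d i ∉ O₀ + O₀) = Finset.univ := by
        refine Finset.filter_true_of_mem fun i _ => ?_
        intro hmem
        obtain ⟨u, hu, v, hv, huv⟩ := Finset.mem_add.mp hmem
        have hu' : u ∈ (↑O₀ : Set ℕ) := hu
        have hv' : v ∈ (↑O₀ : Set ℕ) := hv
        rw [hO₀] at hu' hv'
        obtain ⟨f, hf, hf0, rfl⟩ := hu'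
        obtain ⟨g, hg, hg0, rfl⟩ := hv'
        exact (hTB i f hf g hg hf0 hg0).1 huv.symm
      rw [hall, Finset.card_univ, Fintype.card_fin] at hb₀
      exact hb₀
    · have hall : (Finset.univ.filter fun i : Fin m => d i ∉ Oinf + Oinf) = Finset.univ := by
        refine Finset.filter_true_of_mem fun i _ => ?_
        intro hmem
        obtain ⟨u, hu, v, hv, huv⟩ := Finset.mem_add.mp hmem
        have hu' : u ∈ (↑Oinf : Set ℕ) := hu
        have hv' : v ∈ (↑Oinf : Set ℕ) := hv
        rw [hOinf] at hu' hv'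
        obtain ⟨f, hf, hf0, rfl⟩ := hu'
        obtain ⟨g, hg, hg0, rfl⟩ := hv'
        exact (hTB i f hf g hg hf0 hg0).2.2 huv.symm
      rw [hall, Finset.card_univ, Fintype.card_fin] at hbinf
      exact hbinf

end PolySwallowShape

end Summit.ValiantsHypothesis.ValiantsHypothesis.Theorems
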